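import Summits.Ventures.PercRepro.C025ProfileStagedLine3Main

/-!
# SESSION 4 (continued) — THEOREM L3: `RigidBound` ON 3-POINT-LINE MATROIDS (night-3 g12; proofs/NIGHT3-G12-LINE3.md §4)
The coloop classification (F4): a rank-`4` set of a simple matroid has `0`, `1`, `2` or `≥ 3` coloops; `≥ 3` forces an independent
`4`-set. Each case is a deposit lemma or one of Lemmas 3, 4–8: **`rigidBound_of_line3`**.
-/
open scoped Matroid
namespace PercRepro
open Set Finset ThmH
namespace Staged
variable {α : Type} [DecidableEq α] {M : Matroid α} [M.Finite]

/-- A coloop `b` of a rank-`4` set `S ⊆ gr M` is not in the closure of `S ∖ b`. -/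
theorem notMem_clF_erase_of_coloop {S : Finset α} (hSg : S ⊆ gr M) (hS4 : rkN M S = 4) {b : α}
    (hcol : rkN M (S.erase b) ≤ 3) : b ∉ clF M (S.erase b) := by
  intro h
  have hsub : S ⊆ clF M (S.erase b) := by
    intro w hw
    by_cases hwb : w = b
    · rw [hwb]; exact h
    · exact subset_clF_self ((Finset.erase_subset _ _).trans hSg) (Finset.mem_erase.mpr ⟨hwb, hw⟩)
  have := rkN_le_of_subset_clF (M := M) hsub
  omega

/-- Removing a coloop `c` of `S` from any `T ⊆ S` containing it drops the rank of `T` by exactly one. -/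
theorem rkN_erase_add_one_of_coloop {S : Finset α} (hSg : S ⊆ gr M) (hS4 : rkN M S = 4) {T : Finset α} (hTS : T ⊆ S)
    {c : α} (hc : c ∈ T) (hcol : rkN M (S.erase c) ≤ 3) : rkN M (T.erase c) + 1 = rkN M T := by
  have hcn := notMem_clF_erase_of_coloop hSg hS4 hcol
  have hout : c ∈ outer M (T.erase c) := by
    rw [mem_outer]
    exact ⟨hSg (hTS hc), fun h => hcn (clF_mono (Finset.erase_subset_erase c hTS) h)⟩
  have h := rkN_insert_of_mem_outer (M := M) hout
  rw [Finset.insert_erase hc] at h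
  omega

/-- A rank-`≤ 1` subset of the ground set of a simple matroid has at most one point. -/
theorem card_le_one_of_rkN_le_one (hsimple : ∀ X ⊆ gr M, X.card = 2 → rkN M X = 2) {R : Finset α}
    (hRg : R ⊆ gr M) (h : rkN M R ≤ 1) : R.card ≤ 1 := by
  by_contra hc
  push Not at hc
  obtain ⟨p, hp, q, hq, hpq⟩ := Finset.one_lt_card.mp hc
  have hpair : ({p, q} : Finset α) ⊆ R := by
    intro t ht
    rw [Finset.mem_insert, Finset.mem_singleton] at ht
    rcases ht with rfl | rfl
    · exact hp
    · exact hq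
  have h2 := hsimple _ (hpair.trans hRg) (Finset.card_pair hpq)
  have := rkN_mono (M := M) hpair
  omega

omit [M.Finite] in
/-- Membership in `coloops`. -/
theorem mem_coloops {S : Finset α} {z : α} : z ∈ (S.filter (fun t => rkN M (S.erase t) ≤ 3)) ↔ z ∈ S ∧ rkN M (S.erase z) ≤ 3 := by
  rw [Finset.mem_filter]

/-- **THEOREM L3 (NIGHT3-G12-LINE3.md)**: in a simple matroid of rank `≥ 5` all of whose rank-`≤ 2` sets have `≤ 3` points
(all lines `≤ 3` points), every rank-`4` set has rigid load `≤ 4`. -/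
theorem rigidBound_of_line3 (hsimple : ∀ X ⊆ gr M, X.card = 2 → rkN M X = 2)
    (h3line : ∀ X ⊆ gr M, rkN M X ≤ 2 → X.card ≤ 3) (hR : (5 : ℕ∞) ≤ M.eRank) : RigidBound M := by
  intro S hS
  rw [Profile.mem_levelSet] at hS
  obtain ⟨hSg, hS4'⟩ := hS
  have hS4 : rkN M S = 4 := by rw [rkN_eq_iff]; exact_mod_cast hS4'
  have hKS : (S.filter (fun t => rkN M (S.erase t) ≤ 3)) ⊆ S := Finset.filter_subset _ _
  rcases Nat.lt_or_ge ((S.filter (fun t => rkN M (S.erase t) ≤ 3))).card 3 with hlt | hge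
  · interval_cases h : ((S.filter (fun t => rkN M (S.erase t) ≤ 3))).card
    · -- no coloop
      have hE : (S.filter (fun t => rkN M (S.erase t) ≤ 3)) = ∅ := Finset.card_eq_zero.mp h
      apply rigid_le_four_of_coloopFree hSg
      intro z hz
      by_contra hcon
      push Not at hcon
      have hzK : z ∈ (S.filter (fun t => rkN M (S.erase t) ≤ 3)) := mem_coloops.mpr ⟨hz, by omega⟩
      rw [hE] at hzK
      exact Finset.notMem_empty z hzK
    · -- one coloop x: S = (S ∖ x) ∪ {x}, Lemmas 4–8
      obtain ⟨x, hx⟩ := Finset.card_eq_one.mp h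
      have hxK : x ∈ (S.filter (fun t => rkN M (S.erase t) ≤ 3)) := by rw [hx]; exact Finset.mem_singleton_self x
      obtain ⟨hxS, hxcol⟩ := mem_coloops.mp hxK
      have hC3 : rkN M (S.erase x) = 3 := by
        have := rkN_erase_add_one_of_coloop hSg hS4 (Finset.Subset.refl S) hxS hxcol
        omega
      have hCg : S.erase x ⊆ gr M := (Finset.erase_subset _ _).trans hSg
      have hfree : ∀ z ∈ S.erase x, rkN M ((S.erase x).erase z) = 3 := by
        intro z hz
        rw [Finset.mem_erase] at hz
        have hzn : z ∉ (S.filter (fun t => rkN M (S.erase t) ≤ 3)) := by rw [hx, Finset.mem_singleton]; exact hz.1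
        have hz4 : rkN M (S.erase z) = 4 := by
          have h1 : ¬ rkN M (S.erase z) ≤ 3 := fun hc => hzn (mem_coloops.mpr ⟨hz.2, hc⟩)
          have h2 : rkN M (S.erase z) ≤ 4 := by rw [← hS4]; exact rkN_mono (Finset.erase_subset _ _)
          omega
        have hxz : x ∈ S.erase z := Finset.mem_erase.mpr ⟨fun hh => hz.1 hh.symm, hxS⟩
        have h1 := rkN_erase_add_one_of_coloop hSg hS4 (Finset.erase_subset z S) hxz hxcol
        rw [hz4, Finset.erase_right_comm] at h1
        omega
      have hxout : x ∈ outer M (S.erase x) := by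
        rw [mem_outer]; exact ⟨hSg hxS, notMem_clF_erase_of_coloop hSg hS4 hxcol⟩
      have := rigid_insert_le_four_line3_full h3line hR hCg hC3 hfree hxout
      rw [Finset.insert_erase hxS] at this
      exact this
    · -- two coloops a, x: S = Q ∪ {a, x}, Lemma 3
      obtain ⟨a, x, hax, hK⟩ := Finset.card_eq_two.mp h
      have haK : a ∈ (S.filter (fun t => rkN M (S.erase t) ≤ 3)) := by rw [hK]; exact Finset.mem_insert_self _ _
      have hxK : x ∈ (S.filter (fun t => rkN M (S.erase t) ≤ 3)) := by rw [hK]; exact Finset.mem_insert_of_mem (Finset.mem_singleton_self _)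
      obtain ⟨haS, hacol⟩ := mem_coloops.mp haK
      obtain ⟨hxS, hxcol⟩ := mem_coloops.mp hxK
      have hxSa : x ∈ S.erase a := Finset.mem_erase.mpr ⟨hax.symm, hxS⟩
      have hSeq : S = insert a (insert x ((S.erase a).erase x)) := by
        rw [Finset.insert_erase hxSa, Finset.insert_erase haS]
      have hQg : (S.erase a).erase x ⊆ gr M := ((Finset.erase_subset _ _).trans (Finset.erase_subset _ _)).trans hSg
      have hSa3 : rkN M (S.erase a) = 3 := by
        have := rkN_erase_add_one_of_coloop hSg hS4 (Finset.Subset.refl S) haS hacol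
        omega
      have hQ2 : rkN M ((S.erase a).erase x) = 2 := by
        have := rkN_erase_add_one_of_coloop hSg hS4 (Finset.erase_subset a S) hxSa hxcol
        omega
      have hQc3 : ((S.erase a).erase x).card ≤ 3 := h3line _ hQg (by omega)
      have hQc : ((S.erase a).erase x).card = 3 := by
        by_contra hne
        have hQc2 : ((S.erase a).erase x).card ≤ 2 := by omega
        have hScard : S.card ≤ 4 := by
          have h1 := Finset.card_erase_of_mem hxSa
          have h2 := Finset.card_erase_of_mem haS
          have h3 : 1 ≤ (S.erase a).card := Finset.card_pos.mpr ⟨x, hxSa⟩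
          have h4 : 1 ≤ S.card := Finset.card_pos.mpr ⟨a, haS⟩
          omega
        have hS4c : 4 ≤ S.card := by rw [← hS4]; exact rkN_le_card _
        -- every point is a coloop
        have hall : S ⊆ (S.filter (fun t => rkN M (S.erase t) ≤ 3)) := by
          intro z hz
          rw [mem_coloops]
          refine ⟨hz, ?_⟩
          have := rkN_le_card (M := M) (S.erase z)
          rw [Finset.card_erase_of_mem hz] at this
          omega
        have := Finset.card_le_card hall
        omega
      have haQ : a ∉ (S.erase a).erase x := fun hh => Finset.notMem_erase a S (Finset.mem_of_mem_erase hh)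
      have hxQ : x ∉ (S.erase a).erase x := Finset.notMem_erase x _
      have hS4'' : rkN M (insert a (insert x ((S.erase a).erase x))) = 4 := by rw [← hSeq]; exact hS4
      have := rigid_le_four_two_coloops_line3 hsimple h3line hR hQg (hSg haS) (hSg hxS) hQ2 hQc haQ hxQ hax hS4''
      rw [← hSeq] at this
      exact this
  · -- three coloops: S is an independent 4-set
    obtain ⟨a, ha, b, hb, c, hc, hab, hac, hbc⟩ := Finset.two_lt_card.mp hge
    obtain ⟨haS, hacol⟩ := mem_coloops.mp ha
    obtain ⟨hbS, hbcol⟩ := mem_coloops.mp hb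
    obtain ⟨hcS, hccol⟩ := mem_coloops.mp hc
    have hbSa : b ∈ S.erase a := Finset.mem_erase.mpr ⟨hab.symm, hbS⟩
    have hcSab : c ∈ (S.erase a).erase b := Finset.mem_erase.mpr ⟨hbc.symm, Finset.mem_erase.mpr ⟨hac.symm, hcS⟩⟩
    have h1 := rkN_erase_add_one_of_coloop hSg hS4 (Finset.Subset.refl S) haS hacol
    have h2 := rkN_erase_add_one_of_coloop hSg hS4 (Finset.erase_subset a S) hbSa hbcol
    have h3 := rkN_erase_add_one_of_coloop hSg hS4 ((Finset.erase_subset b _).trans (Finset.erase_subset a S)) hcSab hccol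
    have hR1 : rkN M (((S.erase a).erase b).erase c) ≤ 1 := by omega
    have hRg : ((S.erase a).erase b).erase c ⊆ gr M :=
      (((Finset.erase_subset _ _).trans (Finset.erase_subset _ _)).trans (Finset.erase_subset _ _)).trans hSg
    have hRc := card_le_one_of_rkN_le_one hsimple hRg hR1
    have hScard : S.card = 4 := by
      have e1 := Finset.card_erase_of_mem hcSab
      have e2 := Finset.card_erase_of_mem hbSa
      have e3 := Finset.card_erase_of_mem haS
      have hS4c : 4 ≤ S.card := by rw [← hS4]; exact rkN_le_card _
      have p1 : 1 ≤ ((S.erase a).erase b).card := Finset.card_pos.mpr ⟨c, hcSab⟩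
      have p2 : 1 ≤ (S.erase a).card := Finset.card_pos.mpr ⟨b, hbSa⟩
      have p3 : 1 ≤ S.card := Finset.card_pos.mpr ⟨a, haS⟩
      omega
    exact rigid_le_of_card_four hScard

end Staged
end PercRepro

/-!
# SESSION 4 (continued) — THE ROW `(3,4)` ON 3-POINT-LINE MATROIDS (night-3 g12; proofs/NIGHT3-G12-LINE3.md §0)
`profileIneq_three_four_line3`: Theorem L3 + `profileIneq_three_four_of_rigid` give `(Π_{3,4})` on every simple matroid of rank
`≥ 5` with all lines `≤ 3` points; `hsimple_of_indep` converts the tree's simplicity hypothesis. What remains for the row on EVERY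
finite matroid is the cell's Theorem A (p10: deletion of a point of a `≥ 4`-point line) and the composition.
-/
open scoped Matroid
namespace PercRepro
open Set Finset ThmH
namespace Staged
variable {α : Type} [DecidableEq α] {M : Matroid α} [M.Finite]

omit [DecidableEq α] in
/-- The tree's simplicity hypothesis gives `rkN X = 2` for every two-point `X ⊆ gr M`. -/
theorem hsimple_of_indep (hs : ∀ T ⊆ M.E, T.encard ≤ 2 → M.Indep T) :
    ∀ X ⊆ gr M, X.card = 2 → rkN M X = 2 := by
  intro X hXg hX2
  have hXE : (X : Set α) ⊆ M.E := by rw [← coe_gr]; exact_mod_cast hXg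
  have henc : (X : Set α).encard = 2 := by rw [Set.encard_coe_eq_coe_finsetCard, hX2]; rfl
  have hind := hs (X : Set α) hXE (by rw [henc])
  rw [rkN_eq_iff, hind.eRk_eq_encard, henc]; rfl

/-- **The row `(3,4)` of `(Π)` on simple matroids of rank `≥ 5` with all lines `≤ 3` points** (Theorem L3 + the staged certificate). -/
theorem profileIneq_three_four_line3 (hsimple : ∀ X ⊆ gr M, X.card = 2 → rkN M X = 2)
    (h3line : ∀ X ⊆ gr M, rkN M X ≤ 2 → X.card ≤ 3) (hR : (5 : ℕ∞) ≤ M.eRank) :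
    Profile.ProfileIneq M 3 4 :=
  profileIneq_three_four_of_rigid M (rigidBound_of_line3 hsimple h3line hR)

/-- The same with the tree's simplicity hypothesis. -/
theorem profileIneq_three_four_line3' (hs : ∀ T ⊆ M.E, T.encard ≤ 2 → M.Indep T)
    (h3line : ∀ X ⊆ gr M, rkN M X ≤ 2 → X.card ≤ 3) (hR : (5 : ℕ∞) ≤ M.eRank) :
    Profile.ProfileIneq M 3 4 :=
  profileIneq_three_four_line3 (hsimple_of_indep hs) h3line hR

end Staged
end PercRepro

/-!
# SESSION 4 (continued) — THE HALL FORM `(H⁺_{3,4})` ON 3-POINT-LINE MATROIDS (night-3 g12)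
`hallIneq_three_four_line3`: Theorem L3 + `hallIneq_three_four_of_rigid` give the Hall form of the row `(3,4)` (every family of
rank-`3` sets, C-033's shape) on every simple matroid of rank `≥ 5` with all lines `≤ 3` points.
-/
open scoped Matroid
namespace PercRepro
open Set Finset ThmH
namespace Staged
variable {α : Type} [DecidableEq α] {M : Matroid α} [M.Finite]

/-- **The Hall form of the row `(3,4)` on simple matroids of rank `≥ 5` with all lines `≤ 3` points.** -/
theorem hallIneq_three_four_line3 (hsimple : ∀ X ⊆ gr M, X.card = 2 → rkN M X = 2)
    (h3line : ∀ X ⊆ gr M, rkN M X ≤ 2 → X.card ≤ 3) (hR : (5 : ℕ∞) ≤ M.eRank) :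
    Profile.HallIneq M 3 4 :=
  hallIneq_three_four_of_rigid M (rigidBound_of_line3 hsimple h3line hR)

end Staged
end PercRepro
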